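import Literature.AnabelianGeometry.EtaleTheta.Discharge.Sec5Prop51Example39
import Literature.AnabelianGeometry.EtaleTheta.Discharge.Sec5Prop51Example39NonDilating
import Literature.AnabelianGeometry.EtaleTheta.Discharge.Sec5Prop51NodeReclosed
import Literature.AnabelianGeometry.EtaleTheta.Discharge.Sec3CuspidallyPureZTower
import Literature.AnabelianGeometry.EtaleTheta.Discharge.Sec3Rmk372GenuineBase

/-!
# [EtTh] Prop. 5.1 — the node closer FIRES at CONSTRUCTED genuine-base data in the WEAK monoid vocabulary (ℤ-tower, `Ÿ`-skeleton with cusps): every FACT binder closed (p. 323 / PDF p. 97)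

S. Mochizuki, *The étale theta function and its Frobenioid-theoretic manifestations*, Publ. RIMS **45** (2009)
[cite: MochizukiEtTh2009, Prop 5.1 p.323 (PDF p.97); Ex 3.9 (iv) p.311 (PDF p.85); Rmk 3.7.2 p.306 (PDF p.80)]: Prop. 5.1 «The Frobenioid `C` is
a tempered Frobenioid of rationally standard type over a slim base category `D`, whose monoid type is `ℤ`, and whose divisor monoid `Φ(−)` is
perfect, perf-factorial, non-dilating, and cuspidally pure. In particular, `C` and … `Ψ` satisfy all of the hypotheses of Corollary 3.8,
(i), (ii), (iii); Theorem 4.4.»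

PROOF-ONLY companion (no `def`, no instance, no new named fact).  abc-iut cell, layer L2, seat abc-iut-w6-d047 (gen 4), abc-iut-L2-lead (gen 7)
R946 «EX39(iv) + PROP5.1 CLAUSE-COVERAGE CENSUS», residual (R1) of my census line 2/2: the node closers of EtTh:Prop5.1 re-keyed so far
(abc-iut-w6-d062 `applicability_of_example39_treeMonoidVocab`, abc-iut-f-128 `applicability_of_example39_reclosed`, abc-iut-w6-d079's toy
instance p481101) live in the STRONG vocabulary `treeMonoidVocab`, whereas every CONSTRUCTED multi-object Example 3.9 datum of record (the
ℤ-tower, the `Ÿ`-skeleton with cusps — this seat's `Discharge/Sec3CuspidallyPureZTower.lean`) lives in `treeMonoidVocabWeak` (erratum E-14 /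
F-L2d2-1: strong perf-factoriality fails at infinite coverings).  abc-iut-L2-t9's ORIGINAL closer `Example39Data.applicability_of_example39`
(`Discharge/Sec5Prop51Example39.lean`) is vocabulary-GENERIC; THIS FILE discharges its two vocabulary-sensitive binders at the weak vocabulary and
fires it at the constructed data:
* `Example39Data.isNonDilating_pull_divisorMonoid_thetaFrobenioid_weak` — «non-dilating» ([FrdI] Def. 1.1 (ii) `IsNonDilatingOn` of the divisor monoid of
  `C_α^ell`) for EVERY Example 3.9 datum over `treeMonoidVocabWeak` (abc-iut-w6-d062's `isNonDilating_Φα`; at the weak vocabulary «non-dilating»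
  IS the tree's `IsNonDilating` too);
* `Example39Data.isIntegral_Φ_thetaFrobenioid_ofRlfZWeak` — the F-2363 binder `hΦ` («`Φ` integral», [FrdI] §0) GONE at the weak Def. 3.6 (i)
  data `ofRlfZWeak dm hpf` (whiskered along any functor): `Φ_α^ell(X) ⊆ Φ₀(Y)^rlf`, a submonoid of a cancellative monoid (abc-iut-L6-t12's
  `IsPerfFactorialWeak.Rlf.isCancelMul`, abc-iut-f-128's `IsIntegral.submonoid`);
* **`Example39Data.applicability_of_example39_ofRlfZWeak_bTemp`** — Prop. 5.1 for §5 data over `C₀ := E.thetaFrobenioid α h`, for EVERY Example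
  3.9 datum `E` over a genuine base `B^temp(Π^tp_X)⁰` (`X` a tempered arithmetic group) and weak Def. 3.6 (i) data: «slim» by Rmk. 3.7.2
  (`remark372_holds`), «monoid type `ℤ`» by `rfl`, «non-dilating» and «integral» by the above — residual inputs EXACTLY {the §5 datum `𝔉` with
  `h𝔉`, print's `Ψ`, the three vocabulary pins `hrs`/`h38`/`h44` (print's «In particular» sentence), and Example 3.9 (iv)'s F-0615 `hcp`};
* **`ThetaTowerTempered.prop51_ofInducedSquare`** / **`ZTowerTempered.prop51_ofInducedSquare`** — the SAME at the `Ÿ`-skeleton-with-cusps /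
  ℤ-tower Example 3.9 data with F-0615 CLOSED BY NAME (`…example39_iv_cuspidallyPure_ofInducedSquare(_closed)`, p487523 / p486418): **every
  FACT-LIST binder of the node (F-0615, F-2363) and every structural clause («slim», «ℤ», «perfect», «perf-factorial», «non-dilating») is a
  THEOREM there; residual = {`𝔉`, `h𝔉`, `Ψ`, `hrs`, `h38`, `h44`}** — the first instances of the EtTh:Prop5.1 closer at CONSTRUCTED genuine-base
  multi-object data.
HONEST LABEL: the vocabulary pins are FREE predicates (`VocabParams`; the tree has no [FrdI] Def. 4.5 vocabulary) — abc-iut-L2-t9's all-pins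
form derives them at `treeMonoidVocab` only; the data are combinatorial consistency witnesses (not Tate curves); nothing here bears on [IUTchIII]
Cor. 3.12; typed ≠ proved; no side taken. [claim: MochizukiEtTh2009, status: refereed pre-IUT]
-/

noncomputable section

namespace Literature.AnabelianGeometry.EtaleTheta

open CategoryTheory Opposite Function Literature.AlgebraicGeometry.Frobenioids Literature.AlgebraicGeometry.Frobenioids.QuasiTemperoid
  Literature.AnabelianGeometry.SemiGraphs Literature.AlgebraicGeometry.Frobenioids.QuasiTemperoid.BTempConnected

universe w u v u₀ v₀

namespace Example39Data

/-! ### §1. «non-dilating» and «integral» at the weak vocabulary -/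

section Weak

variable {DW : Type u} [Category.{v} DW] {TW : RealifiedDivisorMonoids (D₀ := DW) treeMonoidVocabWeak.{w}}
  (E : Example39Data treeMonoidVocabWeak.{w} DW TW) {A B : DW} (α : A ⟶ B)

/-- **«non-dilating» for `C_α^ell` at the WEAK vocabulary** ([FrdI] Def. 1.1 (ii) for the divisor monoid `Φ_α^ell`): at `treeMonoidVocabWeak`
the vocabulary's «non-dilating» IS the tree's `IsNonDilating`, so abc-iut-w6-d062's `isNonDilating_Φα` gives `IsNonDilatingOn` verbatim (the
weak twin of `isNonDilatingOn_thetaFrobenioid`). [cite: MochizukiEtTh2009, Prop 5.1 p.323 (PDF p.97); Ex 3.9 (iv) p.311 (PDF p.85)] -/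
theorem isNonDilating_pull_divisorMonoid_thetaFrobenioid_weak {VD : FrdICatStub.{max u v, v, w} (Dα α)} (h : E.FrobenioidHyp α VD) :
    ∀ (X : Dα α) (f : X ⟶ X), IsNonDilating (pull (E.thetaFrobenioid α h).divisorMonoid f) :=
  fun X f => E.isNonDilating_Φα α (op X) f.op

end Weak

section OfRlfZWeak

variable {D₀ : Type u₀} [Category.{v₀} D₀] {dm : DivisorMonoids.{u₀, v₀, w} D₀} (hpf : ∀ Y : D₀ᵒᵖ, IsPerfFactorialCof (dm.Φ₀.obj Y))
  {DW : Type u} [Category.{v} DW] (G : DW ⥤ D₀)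
  (E : Example39Data treeMonoidVocabWeak.{w} DW ((RealifiedDivisorMonoids.ofRlfZWeak dm hpf).precomp G)) {A B : DW} (α : A ⟶ B)

/-- **F-2363 «`Φ` integral» GONE at the weak Def. 3.6 (i) data**: every `Φ_α^ell(X) ⊆ Φ₀(Y)^rlf` (weak realification, whiskered along any
`G : D_W → D₀`) is a submonoid of a cancellative monoid, hence integral ([FrdI] §0). [cite: MochizukiFrdI2008, §0 p.11] -/
theorem isIntegral_Φ_thetaFrobenioid_ofRlfZWeak {VD : FrdICatStub.{max u v, v, w} (Dα α)} (h : E.FrobenioidHyp α VD) :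
    ∀ X : (Dα α)ᵒᵖ, IsIntegral ((E.thetaFrobenioid α h).Φ.carrier X) := fun X => by
  have hM : IsIntegral (hpf (op (G.obj ((toDW α).obj X.unop)))).weak.Rlf :=
    haveI := IsPerfFactorialWeak.Rlf.isCancelMul (hpf (op (G.obj ((toDW α).obj X.unop)))).weak
    isIntegral_iff_isCancelMul.mpr inferInstance
  exact IsIntegral.submonoid hM _

end OfRlfZWeak

/-! ### §2. Prop. 5.1's closer for EVERY Example 3.9 datum over a genuine base `B^temp(Π^tp_X)⁰` and weak Def. 3.6 (i) data -/

section GenuineBase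

variable {K : Type} [Field K] (X : SemiGraphs.TemperedArithmeticGroup.{0} K)
  {D₀ : Type u₀} [Category.{v₀} D₀] {dm : DivisorMonoids.{u₀, v₀, 0} D₀} (hpf : ∀ Y : D₀ᵒᵖ, IsPerfFactorialCof (dm.Φ₀.obj Y))
  (G : ConnectedPart (BTemp X.Pi) ⥤ D₀)
  (E : Example39Data treeMonoidVocabWeak.{0} (ConnectedPart (BTemp X.Pi)) ((RealifiedDivisorMonoids.ofRlfZWeak dm hpf).precomp G))
  {A B : ConnectedPart (BTemp X.Pi)} (α : A ⟶ B)

/-- **Prop. 5.1 for §5 data over `C₀ := E.thetaFrobenioid α h`, EVERY Example 3.9 datum `E` over the genuine base `B^temp(Π^tp_X)⁰` and weak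
Def. 3.6 (i) data** (abc-iut-L2-t9's generic closer `applicability_of_example39` with «slim» := Rmk. 3.7.2, «ℤ» := `rfl`, «non-dilating» and
«integral» := §1): residual inputs = the §5 datum (`𝔉`, `h𝔉`), print's `Ψ`, the three vocabulary pins, and F-0615 `hcp`.
[cite: MochizukiEtTh2009, Prop 5.1 p.323 (PDF p.97)] -/
theorem applicability_of_example39_ofRlfZWeak_bTemp {VD : FrdICatStub.{1, 0, 0} (Dα α)} (h : E.FrobenioidHyp α VD)
    (𝔉 : ThetaFrobenioid.{0} (E.thetaFrobenioid α h).category (Dα α))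
    (P : (E.thetaFrobenioid α h).VocabParams)
    {IsBFT : MorphismProperty (E.thetaFrobenioid α h).category}
    (h𝔉 : 𝔉.toTemperedFrobenioidStub =
      (E.thetaFrobenioid α h).thetaStub (E.isIntegral_Φ_thetaFrobenioid_ofRlfZWeak hpf G α h) IsBFT)
    (Ψ : (E.thetaFrobenioid α h).category ≌ (E.thetaFrobenioid α h).category)
    (hrs : P.IsRationallyStandard) (hcp : E.Example39_iv_cuspidallyPure α h)
    (h38 : P.HypothesesCor38 Ψ) (h44 : P.HypothesesThm44 Ψ) :
    FrobenioidThetaBiKummer.ApplicabilityOfGeneralTheory 𝔉 (TemperedFrobenioid.thetaVocab 𝔉 P) Ψ :=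
  E.applicability_of_example39 α h 𝔉 P h𝔉 Ψ hrs (TemperedArithmeticGroup.remark372_holds X).1 rfl
    (E.isNonDilating_pull_divisorMonoid_thetaFrobenioid_weak α h) hcp h38 h44

end GenuineBase

end Example39Data

/-! ### §3. At the `Ÿ`-skeleton with cusps and at the ℤ-tower: every FACT binder closed -/

namespace ThetaTowerTempered

variable {K : Type} [Field K] (X : SemiGraphs.TemperedArithmeticGroup.{0} K) (φ : X.Pi →* Multiplicative ℤ)
  (R S : ((ConnectedPart (BTemp X.Pi))ᵒᵖ ⥤ CommMonCat.{0}) → Prop)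
  {GU GX GY : Type} [Group GU] [TopologicalSpace GU]
  [Group GX] [TopologicalSpace GX] [IsTopologicalGroup GX] [Group GY] [TopologicalSpace GY] [IsTopologicalGroup GY]
  (iUX : GU →* GX) (iUY : GU →* GY) (iXW : GX →* X.Pi) (iYW : GY →* X.Pi)
  (hUX : IsOpenMap iUX) (hUY : IsOpenMap iUY) (hXW : IsOpenMap iXW) (hYW : IsOpenMap iYW)
  (cUX : Continuous iUX) (cUY : Continuous iUY) (cXW : Continuous iXW) (cYW : Continuous iYW)
  (hQX : ∀ V : Subgroup GX, IsOpen (V : Set GX) → Countable (GX ⧸ V))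
  (hQY : ∀ V : Subgroup GY, IsOpen (V : Set GY) → Countable (GY ⧸ V))
  (hQW : ∀ V : Subgroup X.Pi, IsOpen (V : Set X.Pi) → Countable (X.Pi ⧸ V))
  (hsq : iXW.comp iUX = iYW.comp iUY)
  (ellY : ObjectProperty (ConnectedPart (BTemp GY)))
  (toEllY : ConnectedPart (BTemp GY) ⥤ ellY.FullSubcategory) (adjY : toEllY ⊣ ellY.ι)
  (ellW : ObjectProperty (ConnectedPart (BTemp X.Pi)))
  (toEllW : ConnectedPart (BTemp X.Pi) ⥤ ellW.FullSubcategory) (adjW : toEllW ⊣ ellW.ι)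
  {A B : ConnectedPart (BTemp X.Pi)} (α : A ⟶ B)
  (IsRationalα IsStrictlyRationalα : ((Example39Data.Dα α)ᵒᵖ ⥤ CommMonCat.{0}) → Prop)

/-- **EtTh:Prop5.1's closer FIRES at the `Ÿ`-skeleton-with-cusps Example 3.9 datum** — every FACT-LIST binder (F-0615 cuspidal purity: TWO-SIDED
and CLOSED, `example39_iv_cuspidallyPure_ofInducedSquare_closed`; F-2363 integrality) and every structural clause («slim», «ℤ», «perfect»,
«perf-factorial», «non-dilating» — abc-iut-f-128's `isNonDilating_pull`) is a THEOREM there; residual = the §5 datum `𝔉`/`h𝔉`, print's `Ψ`, and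
the three vocabulary pins. [cite: MochizukiEtTh2009, Prop 5.1 p.323 (PDF p.97)] -/
theorem prop51_ofInducedSquare
    (𝔉 : ThetaFrobenioid.{0}
      ((Example39Data.ofInducedSquare iUX iUY iXW iYW hUX hUY hXW hYW cUX cUY cXW cYW hQX hQY hQW hsq treeMonoidVocabWeak.{0}
        ((RealifiedDivisorMonoids.ofRlfZWeak (dm X φ) (hpf X φ)).precomp (temperedFrobenioid X φ R S).base) ellY toEllY adjY ellW
        toEllW adjW (temperedFrobenioid X φ R S).Φ (hP X φ R S) (temperedFrobenioid X φ R S).isGroupSaturated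
        (temperedFrobenioid X φ R S).isPerfFactorial (isNonDilating_pull X φ R S)).thetaFrobenioid α
        (Example39Data.frobenioidHyp_ofInducedSquare_ofTempered iUX iUY iXW iYW hUX hUY hXW hYW cUX cUY cXW cYW hQX hQY hQW hsq ellY
          toEllY adjY ellW toEllW adjW (temperedFrobenioid X φ R S) (hP X φ R S) (isNonDilating_pull X φ R S) α IsRationalα
          IsStrictlyRationalα)).category (Example39Data.Dα α))
    (P : ((Example39Data.ofInducedSquare iUX iUY iXW iYW hUX hUY hXW hYW cUX cUY cXW cYW hQX hQY hQW hsq treeMonoidVocabWeak.{0}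
        ((RealifiedDivisorMonoids.ofRlfZWeak (dm X φ) (hpf X φ)).precomp (temperedFrobenioid X φ R S).base) ellY toEllY adjY ellW
        toEllW adjW (temperedFrobenioid X φ R S).Φ (hP X φ R S) (temperedFrobenioid X φ R S).isGroupSaturated
        (temperedFrobenioid X φ R S).isPerfFactorial (isNonDilating_pull X φ R S)).thetaFrobenioid α
        (Example39Data.frobenioidHyp_ofInducedSquare_ofTempered iUX iUY iXW iYW hUX hUY hXW hYW cUX cUY cXW cYW hQX hQY hQW hsq ellY
          toEllY adjY ellW toEllW adjW (temperedFrobenioid X φ R S) (hP X φ R S) (isNonDilating_pull X φ R S) α IsRationalα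
          IsStrictlyRationalα)).VocabParams)
    {IsBFT : MorphismProperty
      ((Example39Data.ofInducedSquare iUX iUY iXW iYW hUX hUY hXW hYW cUX cUY cXW cYW hQX hQY hQW hsq treeMonoidVocabWeak.{0}
        ((RealifiedDivisorMonoids.ofRlfZWeak (dm X φ) (hpf X φ)).precomp (temperedFrobenioid X φ R S).base) ellY toEllY adjY ellW
        toEllW adjW (temperedFrobenioid X φ R S).Φ (hP X φ R S) (temperedFrobenioid X φ R S).isGroupSaturated
        (temperedFrobenioid X φ R S).isPerfFactorial (isNonDilating_pull X φ R S)).thetaFrobenioid α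
        (Example39Data.frobenioidHyp_ofInducedSquare_ofTempered iUX iUY iXW iYW hUX hUY hXW hYW cUX cUY cXW cYW hQX hQY hQW hsq ellY
          toEllY adjY ellW toEllW adjW (temperedFrobenioid X φ R S) (hP X φ R S) (isNonDilating_pull X φ R S) α IsRationalα
          IsStrictlyRationalα)).category}
    (h𝔉 : 𝔉.toTemperedFrobenioidStub =
      ((Example39Data.ofInducedSquare iUX iUY iXW iYW hUX hUY hXW hYW cUX cUY cXW cYW hQX hQY hQW hsq treeMonoidVocabWeak.{0}
        ((RealifiedDivisorMonoids.ofRlfZWeak (dm X φ) (hpf X φ)).precomp (temperedFrobenioid X φ R S).base) ellY toEllY adjY ellW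
        toEllW adjW (temperedFrobenioid X φ R S).Φ (hP X φ R S) (temperedFrobenioid X φ R S).isGroupSaturated
        (temperedFrobenioid X φ R S).isPerfFactorial (isNonDilating_pull X φ R S)).thetaFrobenioid α
        (Example39Data.frobenioidHyp_ofInducedSquare_ofTempered iUX iUY iXW iYW hUX hUY hXW hYW cUX cUY cXW cYW hQX hQY hQW hsq ellY
          toEllY adjY ellW toEllW adjW (temperedFrobenioid X φ R S) (hP X φ R S) (isNonDilating_pull X φ R S) α IsRationalα
          IsStrictlyRationalα)).thetaStub
        (Example39Data.isIntegral_Φ_thetaFrobenioid_ofRlfZWeak (hpf X φ) (temperedFrobenioid X φ R S).base _ α _) IsBFT)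
    (Ψ : ((Example39Data.ofInducedSquare iUX iUY iXW iYW hUX hUY hXW hYW cUX cUY cXW cYW hQX hQY hQW hsq treeMonoidVocabWeak.{0}
        ((RealifiedDivisorMonoids.ofRlfZWeak (dm X φ) (hpf X φ)).precomp (temperedFrobenioid X φ R S).base) ellY toEllY adjY ellW
        toEllW adjW (temperedFrobenioid X φ R S).Φ (hP X φ R S) (temperedFrobenioid X φ R S).isGroupSaturated
        (temperedFrobenioid X φ R S).isPerfFactorial (isNonDilating_pull X φ R S)).thetaFrobenioid α
        (Example39Data.frobenioidHyp_ofInducedSquare_ofTempered iUX iUY iXW iYW hUX hUY hXW hYW cUX cUY cXW cYW hQX hQY hQW hsq ellY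
          toEllY adjY ellW toEllW adjW (temperedFrobenioid X φ R S) (hP X φ R S) (isNonDilating_pull X φ R S) α IsRationalα
          IsStrictlyRationalα)).category ≌
      ((Example39Data.ofInducedSquare iUX iUY iXW iYW hUX hUY hXW hYW cUX cUY cXW cYW hQX hQY hQW hsq treeMonoidVocabWeak.{0}
        ((RealifiedDivisorMonoids.ofRlfZWeak (dm X φ) (hpf X φ)).precomp (temperedFrobenioid X φ R S).base) ellY toEllY adjY ellW
        toEllW adjW (temperedFrobenioid X φ R S).Φ (hP X φ R S) (temperedFrobenioid X φ R S).isGroupSaturated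
        (temperedFrobenioid X φ R S).isPerfFactorial (isNonDilating_pull X φ R S)).thetaFrobenioid α
        (Example39Data.frobenioidHyp_ofInducedSquare_ofTempered iUX iUY iXW iYW hUX hUY hXW hYW cUX cUY cXW cYW hQX hQY hQW hsq ellY
          toEllY adjY ellW toEllW adjW (temperedFrobenioid X φ R S) (hP X φ R S) (isNonDilating_pull X φ R S) α IsRationalα
          IsStrictlyRationalα)).category)
    (hrs : P.IsRationallyStandard) (h38 : P.HypothesesCor38 Ψ) (h44 : P.HypothesesThm44 Ψ) :
    FrobenioidThetaBiKummer.ApplicabilityOfGeneralTheory 𝔉 (TemperedFrobenioid.thetaVocab 𝔉 P) Ψ :=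
  Example39Data.applicability_of_example39_ofRlfZWeak_bTemp X (hpf X φ) (temperedFrobenioid X φ R S).base _ α _ 𝔉 P h𝔉 Ψ hrs
    (example39_iv_cuspidallyPure_ofInducedSquare_closed X φ R S iUX iUY iXW iYW hUX hUY hXW hYW cUX cUY cXW cYW hQX hQY hQW hsq ellY
      toEllY adjY ellW toEllW adjW α IsRationalα IsStrictlyRationalα) h38 h44

end ThetaTowerTempered

namespace ZTowerTempered

variable {K : Type} [Field K] (X : SemiGraphs.TemperedArithmeticGroup.{0} K) (φ : X.Pi →* Multiplicative ℤ)
  (R S : ((ConnectedPart (BTemp X.Pi))ᵒᵖ ⥤ CommMonCat.{0}) → Prop)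
  {GU GX GY : Type} [Group GU] [TopologicalSpace GU]
  [Group GX] [TopologicalSpace GX] [IsTopologicalGroup GX] [Group GY] [TopologicalSpace GY] [IsTopologicalGroup GY]
  (iUX : GU →* GX) (iUY : GU →* GY) (iXW : GX →* X.Pi) (iYW : GY →* X.Pi)
  (hUX : IsOpenMap iUX) (hUY : IsOpenMap iUY) (hXW : IsOpenMap iXW) (hYW : IsOpenMap iYW)
  (cUX : Continuous iUX) (cUY : Continuous iUY) (cXW : Continuous iXW) (cYW : Continuous iYW)
  (hQX : ∀ V : Subgroup GX, IsOpen (V : Set GX) → Countable (GX ⧸ V))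
  (hQY : ∀ V : Subgroup GY, IsOpen (V : Set GY) → Countable (GY ⧸ V))
  (hQW : ∀ V : Subgroup X.Pi, IsOpen (V : Set X.Pi) → Countable (X.Pi ⧸ V))
  (hsq : iXW.comp iUX = iYW.comp iUY)
  (ellY : ObjectProperty (ConnectedPart (BTemp GY)))
  (toEllY : ConnectedPart (BTemp GY) ⥤ ellY.FullSubcategory) (adjY : toEllY ⊣ ellY.ι)
  (ellW : ObjectProperty (ConnectedPart (BTemp X.Pi)))
  (toEllW : ConnectedPart (BTemp X.Pi) ⥤ ellW.FullSubcategory) (adjW : toEllW ⊣ ellW.ι)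
  {A B : ConnectedPart (BTemp X.Pi)} (α : A ⟶ B)
  (IsRationalα IsStrictlyRationalα : ((Example39Data.Dα α)ᵒᵖ ⥤ CommMonCat.{0}) → Prop)

/-- **EtTh:Prop5.1's closer FIRES at the ℤ-tower Example 3.9 datum** (F-0615 CLOSED by `example39_iv_cuspidallyPure_ofInducedSquare`, one-sided
there; F-2363 GONE; «non-dilating» by abc-iut-w5-d179's `isNonDilating`); residual = {`𝔉`, `h𝔉`, `Ψ`, pins}.
[cite: MochizukiEtTh2009, Prop 5.1 p.323 (PDF p.97)] -/
theorem prop51_ofInducedSquare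
    (𝔉 : ThetaFrobenioid.{0}
      ((Example39Data.ofInducedSquare iUX iUY iXW iYW hUX hUY hXW hYW cUX cUY cXW cYW hQX hQY hQW hsq treeMonoidVocabWeak.{0}
        ((RealifiedDivisorMonoids.ofRlfZWeak (dm X φ) (hpf X φ)).precomp (temperedFrobenioid X φ R S).base) ellY toEllY adjY ellW
        toEllW adjW (temperedFrobenioid X φ R S).Φ (hP X φ R S) (temperedFrobenioid X φ R S).isGroupSaturated
        (temperedFrobenioid X φ R S).isPerfFactorial (isNonDilating X φ R S)).thetaFrobenioid α
        (Example39Data.frobenioidHyp_ofInducedSquare_ofTempered iUX iUY iXW iYW hUX hUY hXW hYW cUX cUY cXW cYW hQX hQY hQW hsq ellY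
          toEllY adjY ellW toEllW adjW (temperedFrobenioid X φ R S) (hP X φ R S) (isNonDilating X φ R S) α IsRationalα
          IsStrictlyRationalα)).category (Example39Data.Dα α))
    (P : ((Example39Data.ofInducedSquare iUX iUY iXW iYW hUX hUY hXW hYW cUX cUY cXW cYW hQX hQY hQW hsq treeMonoidVocabWeak.{0}
        ((RealifiedDivisorMonoids.ofRlfZWeak (dm X φ) (hpf X φ)).precomp (temperedFrobenioid X φ R S).base) ellY toEllY adjY ellW
        toEllW adjW (temperedFrobenioid X φ R S).Φ (hP X φ R S) (temperedFrobenioid X φ R S).isGroupSaturated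
        (temperedFrobenioid X φ R S).isPerfFactorial (isNonDilating X φ R S)).thetaFrobenioid α
        (Example39Data.frobenioidHyp_ofInducedSquare_ofTempered iUX iUY iXW iYW hUX hUY hXW hYW cUX cUY cXW cYW hQX hQY hQW hsq ellY
          toEllY adjY ellW toEllW adjW (temperedFrobenioid X φ R S) (hP X φ R S) (isNonDilating X φ R S) α IsRationalα
          IsStrictlyRationalα)).VocabParams)
    {IsBFT : MorphismProperty
      ((Example39Data.ofInducedSquare iUX iUY iXW iYW hUX hUY hXW hYW cUX cUY cXW cYW hQX hQY hQW hsq treeMonoidVocabWeak.{0}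
        ((RealifiedDivisorMonoids.ofRlfZWeak (dm X φ) (hpf X φ)).precomp (temperedFrobenioid X φ R S).base) ellY toEllY adjY ellW
        toEllW adjW (temperedFrobenioid X φ R S).Φ (hP X φ R S) (temperedFrobenioid X φ R S).isGroupSaturated
        (temperedFrobenioid X φ R S).isPerfFactorial (isNonDilating X φ R S)).thetaFrobenioid α
        (Example39Data.frobenioidHyp_ofInducedSquare_ofTempered iUX iUY iXW iYW hUX hUY hXW hYW cUX cUY cXW cYW hQX hQY hQW hsq ellY
          toEllY adjY ellW toEllW adjW (temperedFrobenioid X φ R S) (hP X φ R S) (isNonDilating X φ R S) α IsRationalα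
          IsStrictlyRationalα)).category}
    (h𝔉 : 𝔉.toTemperedFrobenioidStub =
      ((Example39Data.ofInducedSquare iUX iUY iXW iYW hUX hUY hXW hYW cUX cUY cXW cYW hQX hQY hQW hsq treeMonoidVocabWeak.{0}
        ((RealifiedDivisorMonoids.ofRlfZWeak (dm X φ) (hpf X φ)).precomp (temperedFrobenioid X φ R S).base) ellY toEllY adjY ellW
        toEllW adjW (temperedFrobenioid X φ R S).Φ (hP X φ R S) (temperedFrobenioid X φ R S).isGroupSaturated
        (temperedFrobenioid X φ R S).isPerfFactorial (isNonDilating X φ R S)).thetaFrobenioid α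
        (Example39Data.frobenioidHyp_ofInducedSquare_ofTempered iUX iUY iXW iYW hUX hUY hXW hYW cUX cUY cXW cYW hQX hQY hQW hsq ellY
          toEllY adjY ellW toEllW adjW (temperedFrobenioid X φ R S) (hP X φ R S) (isNonDilating X φ R S) α IsRationalα
          IsStrictlyRationalα)).thetaStub
        (Example39Data.isIntegral_Φ_thetaFrobenioid_ofRlfZWeak (hpf X φ) (temperedFrobenioid X φ R S).base _ α _) IsBFT)
    (Ψ : ((Example39Data.ofInducedSquare iUX iUY iXW iYW hUX hUY hXW hYW cUX cUY cXW cYW hQX hQY hQW hsq treeMonoidVocabWeak.{0}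
        ((RealifiedDivisorMonoids.ofRlfZWeak (dm X φ) (hpf X φ)).precomp (temperedFrobenioid X φ R S).base) ellY toEllY adjY ellW
        toEllW adjW (temperedFrobenioid X φ R S).Φ (hP X φ R S) (temperedFrobenioid X φ R S).isGroupSaturated
        (temperedFrobenioid X φ R S).isPerfFactorial (isNonDilating X φ R S)).thetaFrobenioid α
        (Example39Data.frobenioidHyp_ofInducedSquare_ofTempered iUX iUY iXW iYW hUX hUY hXW hYW cUX cUY cXW cYW hQX hQY hQW hsq ellY
          toEllY adjY ellW toEllW adjW (temperedFrobenioid X φ R S) (hP X φ R S) (isNonDilating X φ R S) α IsRationalα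
          IsStrictlyRationalα)).category ≌
      ((Example39Data.ofInducedSquare iUX iUY iXW iYW hUX hUY hXW hYW cUX cUY cXW cYW hQX hQY hQW hsq treeMonoidVocabWeak.{0}
        ((RealifiedDivisorMonoids.ofRlfZWeak (dm X φ) (hpf X φ)).precomp (temperedFrobenioid X φ R S).base) ellY toEllY adjY ellW
        toEllW adjW (temperedFrobenioid X φ R S).Φ (hP X φ R S) (temperedFrobenioid X φ R S).isGroupSaturated
        (temperedFrobenioid X φ R S).isPerfFactorial (isNonDilating X φ R S)).thetaFrobenioid α
        (Example39Data.frobenioidHyp_ofInducedSquare_ofTempered iUX iUY iXW iYW hUX hUY hXW hYW cUX cUY cXW cYW hQX hQY hQW hsq ellY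
          toEllY adjY ellW toEllW adjW (temperedFrobenioid X φ R S) (hP X φ R S) (isNonDilating X φ R S) α IsRationalα
          IsStrictlyRationalα)).category)
    (hrs : P.IsRationallyStandard) (h38 : P.HypothesesCor38 Ψ) (h44 : P.HypothesesThm44 Ψ) :
    FrobenioidThetaBiKummer.ApplicabilityOfGeneralTheory 𝔉 (TemperedFrobenioid.thetaVocab 𝔉 P) Ψ :=
  Example39Data.applicability_of_example39_ofRlfZWeak_bTemp X (hpf X φ) (temperedFrobenioid X φ R S).base _ α _ 𝔉 P h𝔉 Ψ hrs
    (example39_iv_cuspidallyPure_ofInducedSquare X φ R S iUX iUY iXW iYW hUX hUY hXW hYW cUX cUY cXW cYW hQX hQY hQW hsq ellY toEllY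
      adjY ellW toEllW adjW α IsRationalα IsStrictlyRationalα) h38 h44

end ZTowerTempered

end Literature.AnabelianGeometry.EtaleTheta

end
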